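import Mathlib

/-!
# Zhang (2022) Appendix A, proof of Lemma 16.1 (ii): the Euler factor of `𝔪₂(1,1;s)` in closed form, and its estimates

Topic `Literature/NumberTheory/LFunctions/Zhang2022` (Landau–Siegel audit tree; verdict-neutral).
Y. Zhang, *Discrete mean estimates and the Landau–Siegel zero*, arXiv:2211.02515v1 (2022)
[Zhang2022LandauSiegel] — **an unrefereed manuscript under adjudication**; this file PROVES elementary
identities and inequalities between explicit rational expressions and asserts nothing about the
manuscript's theorems. Campaign D-0069, DAG nodes `Z22:Lem16.1.pf`, `Z22:§A.u036`–`Z22:§A.u038`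
[Z22 p. 105, tex L5205–5224], feeding `Z22:Lem16.1` [Z22 p. 92, tex L4579] (L4-t5's
`Typed.Section16B.Lemma161`) and the chain `Skeleton.Ded1617`.

The manuscript (App. A p. 105): "Hence `1 + λ̃₂(q,d)Σ_r ξ₂(qʳ;d,l)q^{−rs} = 1 − χ(q)/(q−1)
+ O(α log q/q)` if `(q,l)=1` … On the other hand `(1−q^{−s−β₁})/((1−q^{−s})(1−χ(q)q^{−s}))
= 1/(1−χ(q)q^{−1}) + O(α log q/q)`. It follows that `𝔪₂(d,l;s) = ∏_{q<D,(q,l)=1}(1−χ(q)q^{−1})^{−1}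
(1 − χ(q)/(q−1)) ∏_{q<D,q∣l}(1−χ(q)q^{−1})^{−1} + O(α₁)`. It is direct to verify that in either case
the assertion holds." And §16 p. 91: the Euler factor is "`1 + O(q^{−19/10})` for `σ > 9/10`".

Everything is generic in the prime `q ≥ 2`, `v = χ(q)` (`‖v‖ ≤ 1`), the unimodular `w = q^{−β₁}`
and `x = q^{−s}` (`‖x‖ ≤ 3/5`). With `ξ₂(qʳ;1,1) = w^{r−1}(w−1)/(1−wv/q) − (vq/(q−1))κ₂(q^{r−1})`
(companion file `AppendixAKappa2PrimePowers`) the local series, `λ₂(q)`, the prefactor and hence the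
whole Euler factor `F_q(s)` of `𝔪₂(1,1;s)` are explicit rational functions: `locSer`, `locLam`,
`locPref`, `locF`; `locMain` is `M_q = (1 − χ(q)/(q−1))/(1 − χ(q)/q)`, the factor of Lemma 16.1's `𝔭`.
Kernel-checked: the exact identities `locF_sub_locMain_eq`, `locF_sub_one_eq` and the estimates
`norm_locF_sub_locMain_le : ‖F_q − M_q‖ ≤ 150(‖w−1‖ + ‖1−qx‖)/q²` (the manuscript's `O(α log q/q)`,
one power of `q` sharper, since `‖w−1‖ ≤ |b₁|log q`, `‖1−qx‖ = |1−q^{1−s}|`),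
`norm_locF_sub_one_le : ‖F_q − 1‖ ≤ 225‖x‖/q` (uniform in `|w| ≤ 1`: every prime, however large),
`norm_locMain_sub_one_le : ‖M_q − 1‖ ≤ 4/q²`. Numbers, not adjectives: the constants are crude.

Not here: the identification with L4-t4's typed `calM2Factor`/`calM2star` and L4-t5's `frakp`/`Lemma161`
and the product assembly (file `AppendixALemma161`); Lemma 16.2 ("a sketch only" in print).

## References
* Y. Zhang, arXiv:2211.02515v1 (2022), §16 pp. 90–92, Appendix A p. 105 (proof of Lemma 16.1).
  [cite: Zhang2022LandauSiegel, §16 Lemma 16.1, App. A]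
-/

noncomputable section

open Complex Real

namespace Literature.NumberTheory.LFunctions.Zhang2022.AppendixA

/-! ## §3. The Euler factor of `𝔪₂(1,1;s)` at a prime, in closed form, and its two estimates -/

/-- The prefactor `(1 − q^{−s−β₁})/((1 − q^{−s})(1 − χ(q)q^{−s}))` of the Euler factor of `𝔪₂`
(§16 p. 91), as a function of `v = χ(q)`, `w = q^{−β₁}`, `x = q^{−s}`.
[cite: Zhang2022LandauSiegel, §16 p. 91] -/
def locPref (v w x : ℂ) : ℂ := (1 - w * x) / ((1 - x) * (1 - v * x))

/-- `λ₂(q) = λ₂(q,1) = (1 − χ(q)q^{−1−β₁})/(1 − χ(q)q^{−1})` ((16.5) ff., §16 p. 90) as a function of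
`v = χ(q)`, `w = q^{−β₁}`: `(1 − vw/q)/(1 − v/q)`. [cite: Zhang2022LandauSiegel, §16 p. 90] -/
def locLam (v w : ℂ) (q : ℕ) : ℂ := (1 - v * w / q) / (1 - v / q)

/-- **The local series `Σ_{r≥1} ξ₂(qʳ;1,1) xʳ` in closed form** (App. A p. 105 with (16.7)):
with `ξ₂(qʳ;1,1) = w^{r−1}(w−1)/(1−wv/q) − (vq/(q−1))κ₂(q^{r−1})` one gets
`(w−1)/(1−wv/q) · x/(1−wx) − (vq/(q−1)) · x(1−x)/(1−wx)`. [cite: Zhang2022LandauSiegel, App. A p. 105] -/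
def locSer (v w x : ℂ) (q : ℕ) : ℂ :=
  (w - 1) / (1 - w * v / q) * (x / (1 - w * x)) - v * q / (q - 1) * (x * (1 - x) / (1 - w * x))

/-- **The Euler factor `F_q(s)` of `𝔪₂(1,1;s)` at the prime `q`** (§16 p. 91: prefactor times
`1 + λ̃₂(q,1)Σ_r ξ₂(qʳ;1,1)q^{−rs}`), in closed form. [cite: Zhang2022LandauSiegel, §16 p. 91] -/
def locF (v w x : ℂ) (q : ℕ) : ℂ := locPref v w x * (1 + locLam v w q * locSer v w x q)

/-- **The main term `M_q = (1 − χ(q)/(q−1))/(1 − χ(q)/q)`** of the Euler factor — the local factor of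
Lemma 16.1's `𝔭 = ∏_q (1−χ(q)q^{−1})^{−1}(1 − χ(q)/(q−1))` (§16 p. 92, App. A p. 105).
[cite: Zhang2022LandauSiegel, §16 Lemma 16.1] -/
def locMain (v : ℂ) (q : ℕ) : ℂ := (1 - v / (q - 1)) / (1 - v / q)

/-- The common denominator `(1−x)(1−vx)(q−1)(q−v)`. [cite: Zhang2022LandauSiegel, App. A p. 105] -/
def locDen (v x : ℂ) (q : ℕ) : ℂ := (1 - x) * (1 - v * x) * ((q : ℂ) - 1) * ((q : ℂ) - v)

section Estimates

variable {v w x : ℂ} {q : ℕ}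

/-- `‖1 − y‖ ≥ 2/5` for `‖y‖ ≤ 3/5`. [folklore] -/
private theorem norm_one_sub_ge {y : ℂ} (hy : ‖y‖ ≤ 3 / 5) : 2 / 5 ≤ ‖1 - y‖ := by
  have := norm_sub_norm_le (1 : ℂ) y
  rw [norm_one] at this
  linarith

/-- The denominators of the closed forms do not vanish in the range `‖v‖, ‖w‖ ≤ 1`, `‖x‖ ≤ 3/5`,
`q ≥ 2`. [folklore] -/
private theorem aux_ne (hv : ‖v‖ ≤ 1) (hw : ‖w‖ ≤ 1) (hx : ‖x‖ ≤ 3 / 5) (hq : 2 ≤ q) :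
    (1 - x ≠ 0 ∧ 1 - v * x ≠ 0 ∧ 1 - w * x ≠ 0) ∧
      ((q : ℂ) ≠ 0 ∧ (q : ℂ) - 1 ≠ 0 ∧ (q : ℂ) - v ≠ 0 ∧ (q : ℂ) - w * v ≠ 0) := by
  have hq' : (2 : ℝ) ≤ q := by exact_mod_cast hq
  have hvx : ‖v * x‖ ≤ 3 / 5 := by
    rw [norm_mul]; nlinarith [norm_nonneg v, norm_nonneg x]
  have hwx : ‖w * x‖ ≤ 3 / 5 := by
    rw [norm_mul]; nlinarith [norm_nonneg w, norm_nonneg x]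
  have hwv : ‖w * v‖ ≤ 1 := by
    rw [norm_mul]; nlinarith [norm_nonneg w, norm_nonneg v]
  have hqn : ‖(q : ℂ)‖ = q := by simp
  refine ⟨⟨?_, ?_, ?_⟩, ?_, ?_, ?_, ?_⟩
  · intro h; have := norm_one_sub_ge hx; rw [h, norm_zero] at this; linarith
  · intro h; have := norm_one_sub_ge hvx; rw [h, norm_zero] at this; linarith
  · intro h; have := norm_one_sub_ge hwx; rw [h, norm_zero] at this; linarith
  · exact_mod_cast (show q ≠ 0 by omega)
  · exact_mod_cast sub_ne_zero.mpr (show (q : ℂ) ≠ 1 by exact_mod_cast (show q ≠ 1 by omega))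
  · intro h
    have : ‖(q : ℂ)‖ = ‖v‖ := by rw [sub_eq_zero.mp h]
    rw [hqn] at this; linarith
  · intro h
    have : ‖(q : ℂ)‖ = ‖w * v‖ := by rw [sub_eq_zero.mp h]
    rw [hqn] at this; linarith

/-- **The exact identity behind "`F_q(s) = M_q + O(α log q/q)`"** (App. A p. 105, "direct to verify"):
`F_q − M_q = {v x((q−1) + vq(1−x))(w−1) + v(1−x)(1−qx)} / ((1−x)(1−vx)(q−1)(q−v))` — it vanishes
exactly at `w = 1` (`β₁ = 0`) and `qx = 1` (`s = 1`). [cite: Zhang2022LandauSiegel, App. A p. 105] -/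
theorem locF_sub_locMain_eq (hv : ‖v‖ ≤ 1) (hw : ‖w‖ ≤ 1) (hx : ‖x‖ ≤ 3 / 5) (hq : 2 ≤ q) :
    locF v w x q - locMain v q =
      (v * x * (((q : ℂ) - 1) + v * q * (1 - x)) * (w - 1) + v * (1 - x) * (1 - q * x)) /
        locDen v x q := by
  obtain ⟨⟨h1, h2, h3⟩, h4, h5, h6, h7⟩ := aux_ne hv hw hx hq
  have h6' : (1 : ℂ) - v / q ≠ 0 := by
    rw [one_sub_div h4]; exact div_ne_zero h6 h4
  have h7' : (1 : ℂ) - w * v / q ≠ 0 := by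
    rw [one_sub_div h4]; exact div_ne_zero h7 h4
  have h2' : 1 - x * v ≠ 0 := by rwa [mul_comm] at h2
  have h3' : 1 - x * w ≠ 0 := by rwa [mul_comm] at h3
  have h7'' : (q : ℂ) - v * w ≠ 0 := by rwa [mul_comm] at h7
  have h7''' : (1 : ℂ) - v * w / q ≠ 0 := by rwa [mul_comm] at h7'
  unfold locF locPref locLam locSer locMain locDen
  field_simp
  ring

/-- **The exact identity behind the tail estimate "`F_q(s) = 1 + O(q^{−19/10})`"** (§16 p. 91):
`F_q − 1 = (x·A₁ + x²·A₂)/((1−x)(1−vx)(q−1)(q−v))` with `A₁ = v(−2q+1−qv+v+qw−w+vqw)`,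
`A₂ = v(vq+q−v−vqw)` — the terms of order `x` with coefficient of size `q²` cancel.
[cite: Zhang2022LandauSiegel, §16 p. 91] -/
theorem locF_sub_one_eq (hv : ‖v‖ ≤ 1) (hw : ‖w‖ ≤ 1) (hx : ‖x‖ ≤ 3 / 5) (hq : 2 ≤ q) :
    locF v w x q - 1 =
      (x * (v * (-2 * (q : ℂ) + 1 - q * v + v + q * w - w + v * q * w)) +
        x ^ 2 * (v * (v * (q : ℂ) + q - v - v * q * w))) / locDen v x q := by
  obtain ⟨⟨h1, h2, h3⟩, h4, h5, h6, h7⟩ := aux_ne hv hw hx hq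
  have h6' : (1 : ℂ) - v / q ≠ 0 := by
    rw [one_sub_div h4]; exact div_ne_zero h6 h4
  have h7' : (1 : ℂ) - w * v / q ≠ 0 := by
    rw [one_sub_div h4]; exact div_ne_zero h7 h4
  have h2' : 1 - x * v ≠ 0 := by rwa [mul_comm] at h2
  have h3' : 1 - x * w ≠ 0 := by rwa [mul_comm] at h3
  have h7'' : (q : ℂ) - v * w ≠ 0 := by rwa [mul_comm] at h7
  have h7''' : (1 : ℂ) - v * w / q ≠ 0 := by rwa [mul_comm] at h7'
  unfold locF locPref locLam locSer locDen
  field_simp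
  ring

/-- The denominator is large: `‖(1−x)(1−vx)(q−1)(q−v)‖ ≥ q²/25` for `‖x‖ ≤ 3/5`, `‖v‖ ≤ 1`, `q ≥ 2`.
[cite: Zhang2022LandauSiegel, App. A p. 105] -/
theorem norm_locDen_ge (hv : ‖v‖ ≤ 1) (hx : ‖x‖ ≤ 3 / 5) (hq : 2 ≤ q) :
    (q : ℝ) ^ 2 / 25 ≤ ‖locDen v x q‖ := by
  have hq' : (2 : ℝ) ≤ q := by exact_mod_cast hq
  have hvx : ‖v * x‖ ≤ 3 / 5 := by
    rw [norm_mul]; nlinarith [norm_nonneg v, norm_nonneg x]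
  have e1 : 2 / 5 ≤ ‖1 - x‖ := norm_one_sub_ge hx
  have e2 : 2 / 5 ≤ ‖1 - v * x‖ := norm_one_sub_ge hvx
  have e3 : (q : ℝ) / 2 ≤ ‖(q : ℂ) - 1‖ := by
    have h := norm_sub_norm_le (q : ℂ) 1
    rw [norm_one, Complex.norm_natCast] at h
    linarith
  have e4 : (q : ℝ) / 2 ≤ ‖(q : ℂ) - v‖ := by
    have h := norm_sub_norm_le (q : ℂ) v
    rw [Complex.norm_natCast] at h
    linarith
  unfold locDen
  rw [norm_mul, norm_mul, norm_mul]
  calc (q : ℝ) ^ 2 / 25 = 2 / 5 * (2 / 5) * (q / 2) * (q / 2) := by ring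
    _ ≤ ‖1 - x‖ * ‖1 - v * x‖ * ‖(q : ℂ) - 1‖ * ‖(q : ℂ) - v‖ := by
        gcongr

/-- **"`1 + λ̃₂Σ_rξ₂q^{−rs}` times the prefactor `= (1−χ(q)q^{−1})^{−1}(1 − χ(q)/(q−1)) + O(α log q/q)`"**
(App. A p. 105), in the sharper exact form: for `‖v‖ ≤ 1`, `‖w‖ ≤ 1`, `‖x‖ ≤ 3/5`, `‖qx‖ ≤ 2`, `q ≥ 2`,
`‖F_q − M_q‖ ≤ 150(‖w − 1‖ + ‖1 − qx‖)/q²` (and `‖w−1‖ = |q^{−β₁}−1| ≤ |b₁|log q`,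
`‖1−qx‖ = |1 − q^{1−s}|`). [cite: Zhang2022LandauSiegel, App. A p. 105] -/
theorem norm_locF_sub_locMain_le (hv : ‖v‖ ≤ 1) (hw : ‖w‖ ≤ 1) (hx : ‖x‖ ≤ 3 / 5)
    (hqx : ‖(q : ℂ) * x‖ ≤ 2) (hq : 2 ≤ q) :
    ‖locF v w x q - locMain v q‖ ≤ 150 * (‖w - 1‖ + ‖1 - q * x‖) / (q : ℝ) ^ 2 := by
  have hq' : (2 : ℝ) ≤ q := by exact_mod_cast hq
  have hq0 : (0 : ℝ) < q := by linarith
  rw [locF_sub_locMain_eq hv hw hx hq, norm_div]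
  have hD := norm_locDen_ge hv hx hq
  have hDpos : 0 < ‖locDen v x q‖ := lt_of_lt_of_le (by positivity) hD
  -- numerator bound
  have hxq : ‖x‖ ≤ 2 / q := by
    rw [norm_mul, Complex.norm_natCast] at hqx
    rw [le_div_iff₀ hq0]; linarith
  have hN : ‖v * x * (((q : ℂ) - 1) + v * q * (1 - x)) * (w - 1) + v * (1 - x) * (1 - q * x)‖ ≤
      6 * (‖w - 1‖ + ‖1 - q * x‖) := by
    have hq1 : ‖(q : ℂ) - 1‖ = q - 1 := by
      have : ((q : ℂ) - 1) = ((q - 1 : ℕ) : ℂ) := by push_cast [Nat.cast_sub (by omega : 1 ≤ q)]; ring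
      rw [this, Complex.norm_natCast, Nat.cast_sub (by omega : 1 ≤ q), Nat.cast_one]
    have t1 : ‖((q : ℂ) - 1) + v * q * (1 - x)‖ ≤ 13 / 5 * q := by
      calc ‖((q : ℂ) - 1) + v * q * (1 - x)‖ ≤ ‖(q : ℂ) - 1‖ + ‖v * q * (1 - x)‖ := norm_add_le _ _
        _ ≤ (q - 1) + 1 * q * (1 + 3 / 5) := by
            rw [hq1]
            gcongr
            rw [norm_mul, norm_mul, Complex.norm_natCast]
            gcongr
            calc ‖1 - x‖ ≤ ‖(1 : ℂ)‖ + ‖x‖ := norm_sub_le _ _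
              _ ≤ 1 + 3 / 5 := by rw [norm_one]; gcongr
        _ ≤ 13 / 5 * q := by linarith
    have t2 : ‖v * x * (((q : ℂ) - 1) + v * q * (1 - x)) * (w - 1)‖ ≤ 26 / 5 * ‖w - 1‖ := by
      rw [norm_mul, norm_mul, norm_mul]
      calc ‖v‖ * ‖x‖ * ‖((q : ℂ) - 1) + v * q * (1 - x)‖ * ‖w - 1‖
          ≤ 1 * (2 / q) * (13 / 5 * q) * ‖w - 1‖ := by gcongr
        _ = 26 / 5 * ‖w - 1‖ := by field_simp; ring
    have t3 : ‖v * (1 - x) * (1 - q * x)‖ ≤ 8 / 5 * ‖1 - q * x‖ := by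
      rw [norm_mul, norm_mul]
      calc ‖v‖ * ‖1 - x‖ * ‖1 - (q : ℂ) * x‖ ≤ 1 * (1 + 3 / 5) * ‖1 - (q : ℂ) * x‖ := by
            gcongr
            calc ‖1 - x‖ ≤ ‖(1 : ℂ)‖ + ‖x‖ := norm_sub_le _ _
              _ ≤ 1 + 3 / 5 := by rw [norm_one]; gcongr
        _ = 8 / 5 * ‖1 - (q : ℂ) * x‖ := by ring
    calc _ ≤ ‖v * x * (((q : ℂ) - 1) + v * q * (1 - x)) * (w - 1)‖ + ‖v * (1 - x) * (1 - q * x)‖ :=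
          norm_add_le _ _
      _ ≤ 26 / 5 * ‖w - 1‖ + 8 / 5 * ‖1 - q * x‖ := add_le_add t2 t3
      _ ≤ 6 * (‖w - 1‖ + ‖1 - q * x‖) := by
          nlinarith [norm_nonneg (w - 1), norm_nonneg (1 - (q : ℂ) * x)]
  calc _ ≤ 6 * (‖w - 1‖ + ‖1 - q * x‖) / ((q : ℝ) ^ 2 / 25) := by
        gcongr
    _ = 150 * (‖w - 1‖ + ‖1 - q * x‖) / (q : ℝ) ^ 2 := by
        field_simp; ring

/-- **The tail estimate: `‖F_q(s) − 1‖ ≤ 225‖q^{−s}‖/q`** for `‖v‖ ≤ 1`, `‖w‖ ≤ 1`, `‖x‖ ≤ 3/5`,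
`q ≥ 2` — uniformly in the unimodular `w`, so it holds for EVERY prime however large (§16 p. 91:
"`= 1 + O(q^{−19/10})` for `σ > 9/10`"; here `q^{−1−σ}`). [cite: Zhang2022LandauSiegel, §16 p. 91] -/
theorem norm_locF_sub_one_le (hv : ‖v‖ ≤ 1) (hw : ‖w‖ ≤ 1) (hx : ‖x‖ ≤ 3 / 5) (hq : 2 ≤ q) :
    ‖locF v w x q - 1‖ ≤ 225 * ‖x‖ / q := by
  have hq' : (2 : ℝ) ≤ q := by exact_mod_cast hq
  have hq0 : (0 : ℝ) < q := by linarith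
  rw [locF_sub_one_eq hv hw hx hq, norm_div]
  have hD := norm_locDen_ge hv hx hq
  have hDpos : 0 < ‖locDen v x q‖ := lt_of_lt_of_le (by positivity) hD
  have hqn : ‖(q : ℂ)‖ = q := Complex.norm_natCast q
  have hA1 : ‖v * (-2 * (q : ℂ) + 1 - q * v + v + q * w - w + v * q * w)‖ ≤ 5 * q + 3 := by
    rw [norm_mul]
    calc ‖v‖ * ‖-2 * (q : ℂ) + 1 - q * v + v + q * w - w + v * q * w‖
        ≤ 1 * (2 * q + 1 + q * 1 + 1 + q * 1 + 1 + 1 * q * 1) := by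
          gcongr
          calc ‖-2 * (q : ℂ) + 1 - q * v + v + q * w - w + v * q * w‖
              ≤ ‖-2 * (q : ℂ)‖ + ‖(1 : ℂ)‖ + ‖(q : ℂ) * v‖ + ‖v‖ + ‖(q : ℂ) * w‖ + ‖w‖ +
                ‖v * q * w‖ := by
                refine le_trans (norm_add_le _ _) ?_; gcongr
                refine le_trans (norm_sub_le _ _) ?_; gcongr
                refine le_trans (norm_add_le _ _) ?_; gcongr
                refine le_trans (norm_add_le _ _) ?_; gcongr
                refine le_trans (norm_sub_le _ _) ?_; gcongr
                exact norm_add_le _ _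
            _ ≤ 2 * q + 1 + q * 1 + 1 + q * 1 + 1 + 1 * q * 1 := by
                simp only [norm_mul, norm_neg, norm_one, Complex.norm_natCast, Complex.norm_ofNat]
                gcongr
      _ = 5 * q + 3 := by ring
  have hA2 : ‖v * (v * (q : ℂ) + q - v - v * q * w)‖ ≤ 3 * q + 1 := by
    rw [norm_mul]
    calc ‖v‖ * ‖v * (q : ℂ) + q - v - v * q * w‖ ≤ 1 * (1 * q + q + 1 + 1 * q * 1) := by
          gcongr
          calc ‖v * (q : ℂ) + q - v - v * q * w‖ ≤ ‖v * (q : ℂ)‖ + ‖(q : ℂ)‖ + ‖v‖ + ‖v * q * w‖ := by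
                refine le_trans (norm_sub_le _ _) ?_; gcongr
                refine le_trans (norm_sub_le _ _) ?_; gcongr
                exact norm_add_le _ _
            _ ≤ 1 * q + q + 1 + 1 * q * 1 := by
                simp only [norm_mul, Complex.norm_natCast]
                gcongr
      _ = 3 * q + 1 := by ring
  have hN : ‖x * (v * (-2 * (q : ℂ) + 1 - q * v + v + q * w - w + v * q * w)) +
      x ^ 2 * (v * (v * (q : ℂ) + q - v - v * q * w))‖ ≤ 9 * q * ‖x‖ := by
    calc _ ≤ ‖x * (v * (-2 * (q : ℂ) + 1 - q * v + v + q * w - w + v * q * w))‖ +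
          ‖x ^ 2 * (v * (v * (q : ℂ) + q - v - v * q * w))‖ := norm_add_le _ _
      _ ≤ ‖x‖ * (5 * q + 3) + ‖x‖ ^ 2 * (3 * q + 1) := by
          simp only [norm_mul, norm_pow]
          gcongr
          · exact le_of_eq_of_le (norm_mul _ _).symm hA1
          · exact le_of_eq_of_le (norm_mul _ _).symm hA2
      _ ≤ ‖x‖ * (5 * q + 3) + ‖x‖ * (3 / 5) * (3 * q + 1) := by
          have : ‖x‖ ^ 2 ≤ ‖x‖ * (3 / 5) := by rw [sq]; gcongr
          nlinarith
      _ ≤ 9 * q * ‖x‖ := by nlinarith [norm_nonneg x]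
  calc _ ≤ 9 * q * ‖x‖ / ((q : ℝ) ^ 2 / 25) := by gcongr
    _ = 225 * ‖x‖ / q := by field_simp; ring

/-- `M_q − 1 = −v/((q−1)(q−v))`, so `‖M_q − 1‖ ≤ 4/q²` (`‖v‖ ≤ 1`, `q ≥ 2`): the factors of `𝔭` are
`1 + O(q^{−2})`, `𝔭` converges absolutely. [cite: Zhang2022LandauSiegel, §16 Lemma 16.1] -/
theorem norm_locMain_sub_one_le (hv : ‖v‖ ≤ 1) (hq : 2 ≤ q) :
    ‖locMain v q - 1‖ ≤ 4 / (q : ℝ) ^ 2 := by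
  have hq' : (2 : ℝ) ≤ q := by exact_mod_cast hq
  obtain ⟨-, h4, h5, h6, -⟩ := aux_ne hv (le_of_eq norm_one) (show ‖(0:ℂ)‖ ≤ 3 / 5 by norm_num) hq
  have e : locMain v q - 1 = -v / (((q : ℂ) - 1) * ((q : ℂ) - v)) := by
    have h6' : (1 : ℂ) - v / q ≠ 0 := by rw [one_sub_div h4]; exact div_ne_zero h6 h4
    unfold locMain
    field_simp
    ring
  rw [e, norm_div, norm_neg, norm_mul]
  have e3 : (q : ℝ) / 2 ≤ ‖(q : ℂ) - 1‖ := by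
    have h := norm_sub_norm_le (q : ℂ) 1
    rw [norm_one, Complex.norm_natCast] at h; linarith
  have e4 : (q : ℝ) / 2 ≤ ‖(q : ℂ) - v‖ := by
    have h := norm_sub_norm_le (q : ℂ) v
    rw [Complex.norm_natCast] at h; linarith
  calc ‖v‖ / (‖(q : ℂ) - 1‖ * ‖(q : ℂ) - v‖) ≤ 1 / ((q : ℝ) / 2 * ((q : ℝ) / 2)) := by
        gcongr
    _ = 4 / (q : ℝ) ^ 2 := by field_simp; ring

/-- `‖M_q‖ ≤ 2` (`‖v‖ ≤ 1`, `q ≥ 2`). [cite: Zhang2022LandauSiegel, §16 Lemma 16.1] -/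
theorem norm_locMain_le (hv : ‖v‖ ≤ 1) (hq : 2 ≤ q) : ‖locMain v q‖ ≤ 2 := by
  have hq' : (2 : ℝ) ≤ q := by exact_mod_cast hq
  have h := norm_locMain_sub_one_le hv hq
  have h1 : 4 / (q : ℝ) ^ 2 ≤ 1 := by
    rw [div_le_one (by positivity)]; nlinarith
  calc ‖locMain v q‖ = ‖(locMain v q - 1) + 1‖ := by ring_nf
    _ ≤ ‖locMain v q - 1‖ + ‖(1 : ℂ)‖ := norm_add_le _ _
    _ ≤ 2 := by rw [norm_one]; linarith

end Estimates

end Literature.NumberTheory.LFunctions.Zhang2022.AppendixA
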